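import Summits.AtomisticToContinuum.FouriersLaw.Theses.CageBudgetFekete
import Summits.AtomisticToContinuum.FouriersLaw.Theses.HoelderEscapeProfile
import Summits.AtomisticToContinuum.FouriersLaw.Theorems.HoelderEscapeProfileFibreCalculus
import Summits.AtomisticToContinuum.FouriersLaw.Theorems.CageBudgetFeketeUnboundedHeatVarianceIrOfNoFrozenSiteEnergy
import HarnessLib

/-!
# `CageBudgetFekete.UnboundedHeatVariance`, line Sketch — local energy ½-Hölder (K1) ⟹ infrared non-freezing

Support file (`--supports stmt-AtomisticToContinuum-15771`) for the stub
`stub_infraredNonFreezing_of_localEnergyHalfHoelder` of line `Sketch` (dependency edge K1 ⟹ IR).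

In the arena of the crux let `S(x,t) = Cov(h₀, h_x ∘ φ_t)` be the energy kernel,
`S̄_ν(x) = ν ∫₀^∞ e^{-νt} S(x,t) dt` its Abel profile, `f̂_ν(k) = Σ_x cos(kx) S̄_ν(x)` and
`χ(k) = Σ_x cos(kx) S(x,0)`. The open crux K1 of route HoelderEscapeProfile
(`HoelderEscapeProfile.LocalEnergyHalfHoelder`) bounds the on-site Abel return: `S̄_ν(0) ≤ C √ν` for
`0 < ν ≤ ν₀`. The LANDED fibre calculus (`FibreCalculusSketch.fibreCalculus_proof`) supplies K1's integrability
hypothesis (clause 3 at `x = 0`) and the lower bound `0 ≤ S̄_ν(0)` (clause 8, Bochner `f̂_ν ≥ 0`, with clause 9,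
Parseval `∫_{-π}^{π} f̂_ν = 2π S̄_ν(0)`). Squeezing, `S̄_ν(0) → 0` as `ν ↓ 0` ("no frozen site energy"), and the
LANDED edge `stub_infraredNonFreezingOfNoFrozenSiteEnergy` (wavenumber pigeonhole) yields infrared non-freezing:
for every `M` and `ν₁ > 0` some `k` with `cos k ≠ 1` and some `0 < ν < ν₁` have
`M (2 - 2 cos k) ≤ χ(k) - f̂_ν(k)`.
-/

noncomputable section

namespace Summit.AtomisticToContinuum.FouriersLaw.Theorems.UnboundedHeatVariance.Sketch

open MeasureTheory Set Filter Topology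
open Literature.MathematicalPhysics.KineticTheory.HeatConduction

/-- **Squeeze to no frozen site energy** (abstract form). If `0 ≤ Ψ ν` for every `ν > 0` and
`Ψ ν ≤ C √ν` for `0 < ν ≤ ν₀` (some `ν₀ > 0`), then `Ψ ν → 0` as `ν ↓ 0`. [folklore] -/
theorem tendsto_zero_of_nonneg_of_le_mul_sqrt (Ψ : ℝ → ℝ) (C ν₀ : ℝ) (hν₀ : 0 < ν₀)
    (h0 : ∀ ν, 0 < ν → 0 ≤ Ψ ν) (hC : ∀ ν, 0 < ν → ν ≤ ν₀ → Ψ ν ≤ C * Real.sqrt ν) :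
    Tendsto Ψ (𝓝[>] 0) (𝓝 0) := by
  have hpos : ∀ᶠ ν in 𝓝[>] (0:ℝ), 0 < ν := eventually_mem_nhdsWithin
  have hle : ∀ᶠ ν in 𝓝[>] (0:ℝ), ν ≤ ν₀ := nhdsWithin_le_nhds (Iic_mem_nhds hν₀)
  have hup : Tendsto (fun ν : ℝ => C * Real.sqrt ν) (𝓝[>] 0) (𝓝 0) := by
    have e : Tendsto (fun ν : ℝ => C * Real.sqrt ν) (𝓝 0) (𝓝 (C * Real.sqrt 0)) :=
      ((continuous_const.mul Real.continuous_sqrt).tendsto 0)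
    rw [Real.sqrt_zero, mul_zero] at e
    exact e.mono_left nhdsWithin_le_nhds
  exact tendsto_of_tendsto_of_tendsto_of_le_of_le' tendsto_const_nhds hup
    (hpos.mono fun ν hν => h0 ν hν) ((hpos.and hle).mono fun ν hν => hC ν hν.1 hν.2)

/-- **Nonnegative on-site Abel return** from Bochner and Parseval (abstract form): if `0 ≤ f k` for all `k`
and `∫_{-π}^{π} f = 2π a`, then `0 ≤ a`. [folklore] -/
theorem nonneg_of_parseval_of_nonneg (f : ℝ → ℝ) (a : ℝ) (hfn : ∀ k, 0 ≤ f k)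
    (hfi : ∫ k in (-Real.pi)..Real.pi, f k = 2 * Real.pi * a) : 0 ≤ a := by
  have h1 : 0 ≤ ∫ k in (-Real.pi)..Real.pi, f k :=
    intervalIntegral.integral_nonneg (by linarith [Real.pi_pos]) fun k _ => hfn k
  rw [hfi] at h1
  exact (mul_nonneg_iff_of_pos_left (by positivity)).mp h1

/-- **Stub `stub_infraredNonFreezing_of_localEnergyHalfHoelder`** (dependency edge K1 ⟹ IR of line `Sketch` of
`CageBudgetFekete.UnboundedHeatVariance`). If the on-site energy is `½`-Hölder in Abel mean
(`HoelderEscapeProfile.LocalEnergyHalfHoelder`: `S̄_ν(0) ≤ C √ν` for small `ν > 0`), then in the arena of the crux,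
with the energy kernel `S`, its Abel profile `Sb`, the Abel structure factor `fh ν k = Σ_x cos(kx) Sb ν x` and the
static one `χk k = Σ_x cos(kx) S x 0`, for every `M` and every `ν₁ > 0` some wavenumber `k` with `cos k ≠ 1` and
some `0 < ν < ν₁` have Abel deficit `χk k - fh ν k ≥ M (2 - 2 cos k)`: squeeze `0 ≤ Sb ν 0 ≤ C √ν` (lower bound by
Bochner + Parseval, clauses 8–9 of the landed fibre calculus; K1's integrability input is its clause 3 at `x = 0`)
and apply the landed edge `stub_infraredNonFreezingOfNoFrozenSiteEnergy`. -/
theorem stub_infraredNonFreezing_of_localEnergyHalfHoelder :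
    Summit.AtomisticToContinuum.FouriersLaw.Theses.HoelderEscapeProfile.LocalEnergyHalfHoelder → ∀ ω₂ lam β γ : ℝ, 0 < ω₂ → 0 < lam → 0 < β → ∀ T : ℝ, 0 < T → ∀ μ : MeasureTheory.Measure Literature.MathematicalPhysics.KineticTheory.HeatConduction.ChainConfig, (Literature.MathematicalPhysics.KineticTheory.HeatConduction.pinnedChain ω₂ lam β γ).IsChainGibbsMeasure T μ → Literature.MathematicalPhysics.KineticTheory.HeatConduction.IsShiftInvariant μ → μ.map (fun σ : Literature.MathematicalPhysics.KineticTheory.HeatConduction.ChainConfig => fun x : ℤ => ((σ x).1, -(σ x).2)) = μ → ∀ D : Literature.MathematicalPhysics.KineticTheory.HeatConduction.InfiniteChainDynamics (Literature.MathematicalPhysics.KineticTheory.HeatConduction.pinnedChain ω₂ lam β γ), D.PreservesMeasure μ → (∀ t : ℝ, ∀ᵐ σ ∂μ, D.flow t (Literature.MathematicalPhysics.KineticTheory.HeatConduction.shift σ) = Literature.MathematicalPhysics.KineticTheory.HeatConduction.shift (D.flow t σ)) → (∀ t : ℝ, D.HasAbsConvergentCorrelation μ t) → Continuous (fun t : ℝ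 => D.currentCorrelation μ t) → ∀ h : Literature.MathematicalPhysics.KineticTheory.HeatConduction.ChainConfig → ℤ → ℝ, h = (fun (σ : Literature.MathematicalPhysics.KineticTheory.HeatConduction.ChainConfig) (x : ℤ) => (σ x).2 ^ 2 / 2 + (Literature.MathematicalPhysics.KineticTheory.HeatConduction.pinnedChain ω₂ lam β γ).U (σ x).1 + ((Literature.MathematicalPhysics.KineticTheory.HeatConduction.pinnedChain ω₂ lam β γ).V ((σ (x + 1)).1 - (σ x).1) + (Literature.MathematicalPhysics.KineticTheory.HeatConduction.pinnedChain ω₂ lam β γ).V ((σ x).1 - (σ (x - 1)).1)) / 2) → ∀ S : ℤ → ℝ → ℝ, S = (fun (x : ℤ) (t : ℝ) => ∫ σ, (h σ 0 - ∫ σ', h σ' 0 ∂μ) * (h (D.flow t σ) x - ∫ σ', h σ' 0 ∂μ) ∂μ) → ∀ Sb : ℝ → ℤ → ℝ, Sb = (fun (ν : ℝ) (x : ℤ) => ν * ∫ t in Set.Ioi (0:ℝ), Real.exp (-(ν * t)) * S x t) → ∀ fh : ℝ → ℝ → ℝ, fh = (fun (ν k : ℝ) => ∑' x : ℤ, Real.cos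 (k * (x : ℝ)) * Sb ν x) → ∀ χk : ℝ → ℝ, χk = (fun k : ℝ => ∑' x : ℤ, Real.cos (k * (x : ℝ)) * S x 0) → ∀ M ν₁ : ℝ, 0 < ν₁ → ∃ k : ℝ, Real.cos k ≠ 1 ∧ ∃ ν : ℝ, 0 < ν ∧ ν < ν₁ ∧ M * (2 - 2 * Real.cos k) ≤ χk k - fh ν k := by
  intro hK1 ω₂ lam β γ hω hl hβ T hT μ hG hSI hRefl D hP hShift hAC hCc h hh S hS Sb hSb fh hfh χk hχk
  refine stub_infraredNonFreezingOfNoFrozenSiteEnergy ω₂ lam β γ hω hl hβ T hT μ hG hSI hRefl D hP hShift hAC hCc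
    h hh S hS Sb hSb fh hfh χk hχk ?_
  obtain ⟨_, _, h3, _, _, _, _, h8, h9, _, _, _⟩ :=
    Summit.AtomisticToContinuum.FouriersLaw.Theorems.FibreCalculusSketch.fibreCalculus_proof ω₂ lam β γ hω hl hβ T
      hT μ hG hSI hRefl D hP hShift h hh S hS Sb hSb _ rfl _ rfl fh hfh χk hχk
  obtain ⟨C, ν₀, hν₀, hK⟩ := hK1 ω₂ lam β γ hω hl hβ T hT μ hG hSI hRefl D hP hShift h hh S hS (h3 0)
  refine tendsto_zero_of_nonneg_of_le_mul_sqrt (fun ν => Sb ν 0) C ν₀ hν₀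
    (fun ν hν => nonneg_of_parseval_of_nonneg (fh ν) (Sb ν 0) (h8 ν hν) (h9 ν hν)) (fun ν hν hνle => ?_)
  show Sb ν 0 ≤ C * Real.sqrt ν
  rw [hSb]
  exact hK ν hν hνle

end Summit.AtomisticToContinuum.FouriersLaw.Theorems.UnboundedHeatVariance.Sketch

end
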